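import Literature.MathematicalPhysics.QuantumFieldTheory.Balaban1983to89.Beta.AveragedAFCarrierCertified
import Literature.MathematicalPhysics.QuantumFieldTheory.Balaban1983to89.Beta.AliasingTailStrata

/-!
# Beta / CapRows — BINDER-OWNERS row CAP-k, item (a′): the binf-FREE slim certificate carrier for the (R15) certified road
# (β sub-cell, DEDICATED row BETA-an5, lineage `b2b-balaban-beta-an5` = OWNER of row CAP-k «CAP k-instantiation: from the k = 0 rows to the
# k ≤ k₀ statement the wall consumes»; §1–§3 staged gen 18, §4–§5 + filing gen 19 = the lineage's first PROVER seat)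

HONEST FRAMING (page 1 of everything the β sub-cell writes): discharging `BetaPertH` makes Bałaban's UV stability UNCONDITIONAL — a
real constructive-QFT result; it is NOT the continuum limit and NOT the Clay problem.  HONEST DEPENDENCY (cell reorg 2026-08-19, verbatim):
«continuum YM on T⁴ ⇐ BetaPertH ∧ nine spine estimates (0/9 proved); BetaPertH ⇐ (D1) ∧ (D4) ∧ CAP+tail; G-an2-4 gates asym, D1 and NE2/3/4.»
THIS MODULE IS PLUMBING: it instantiates NO binder; it turns a finite list of certified rational lower bounds `lo k ≤ b k` (`k ≤ k₀`) for an
ABSTRACT sequence `b` (intended `b = S.β0`, Bałaban's one-loop coefficients `β⁰_{k+1}` of (2.12)–(2.14) — nothing about that family is asserted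
by having the structure) into EXACTLY the three computational leaves of the certified road of asym2's `RemainderConstCertified` × the co-lead's
`AveragedAFCarrierCertified.betaAvgAFH_of_certifiedConst_list`: `hcert : m ≤ b k₁`, `hsmall : ∀ k < k₂, m₀ ≤ b k` with `k₁ := k₀`,
`k₂ := k₀ + 1`, `m := lo k₀`, `m₀ := min_{k ≤ k₀} lo k`; the rate-side inequality `hk₂ : c₀θ^{k₀+1} ≤ (m − c₀θ^{k₀})/4` stays a binder
(a decidable rational comparison once `c₀`, `θ` are rational enclosures of the asymptotic lane).

ABSOLUTE RULE (cell charter, verbatim): "No internally-minted statement may enter as a cited fact. Every hypothesis is either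
kernel-proved in this package or a verbatim quotation of a PUBLISHED theorem with page reference. The manuscript(s) under audit are
NOT citable for their own disputed steps — they are the thing under adjudication; programme-internal (2001/route/tribunal) claims
are never citable."

WHY A SECOND CARRIER next to cap3's `Certified.SmallKCert b binf` (which EXISTS and is the export socket of the cap lane into
`Assembly.LimitForm`): `SmallKCert` is stated against the LIMIT VALUE `binf` (fields `bhi`, `binf_le`, thresholds `3·bhi/4 ≤ lo k`) — the
currency of the limit-form road; the (R15) certified road (`betaAvgAFH_of_certifiedConst(_list)`, `certifiedConst_END_allProfiles`) is
binf-FREE by design («`binf` ANY real — its sign is never assumed»): one certified value `m ≤ β⁰_{k₁}` replaces `β⁰_∞`.  `CapRows.Rows b` carries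
only `lo_le`; `Rows.toSmallKCert` recovers cap3's carrier when a `bhi` with the thresholds is supplied, and `Rows.ofSmallKCert` goes back.
THE LEVEL-k DICTIONARY is the constructor `Rows.ofDict`: rows certified for a TYPED sequence `T` (the engines' assembled objects, step by
step) plus the identification `∀ k ≤ k₀, b k = T k` — a HYPOTHESIS ((D1)-grade at each level; RULING (R30): the cap (S4) interval is the k = 0
anchor / level-0 dictionary test only) — give `Rows b`.  ORDER OF THE ROW (BINDER-OWNERS CAP-k): SU2-coef TOTAL at k = 0 (0 rows today) →
level-0 dictionary → `Rows.ofDict` with `k₀ = 0` → per-k TOTALs or the asymptotic lane's k-uniformity for `0 < k ≤ k₀`.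

CONTENTS. §1 `Rows`, `m`, `m₀`, `hcert`, `hsmall`, `restrict`, `ofDict`, `toSmallKCert`/`ofSmallKCert`. §2 EXPORT: `betaAvgAFH_of_capRows`
(= `betaAvgAFH_of_certifiedConst_list` on the carrier), `certifiedConst_END_allProfiles_of_capRows`-type consumers are the co-lead's by
`c.hcert`/`c.hsmall` (not restated). §3 NON-VACUITY: the one-row carrier on asym2's witness `splitOne` (`β⁰ ≡ 1`, `lo 0 = 1`).
§4 FEASIBILITY OF THE ANCHOR (what the rate side must supply): `hk₂ ↔ c₀θ^{k₀}(1+4θ) ≤ m`, `GeomRate ⇒ |b 0 − binf| ≤ c₀`, hence the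
NECESSARY conditions `θ^{k₀}(1+4θ)|b 0 − binf| ≤ m` (certified road) ∕ `θ^{k₁}(1+θ)|b 0 − binf| ≤ m − r` (margin road), the `k₀ = 0`
solved form `θ ≤ binf/(4(b 0 − binf))` and one worked size under explicit numerical HYPOTHESES.  §5 THE `k₀ = 0` ANCHOR ROW from cap3's
aliasing leaves in the binf-free currency (`Rows.ofAliasing` sup-norm rate ∕ `Rows.ofAliasingL1` ℓ¹ rate) and the certified road on it
(`betaAvgAFH_of_anchorL1`) — the shell of row CAP-k item (b); no integrand, period or number is instantiated.
-/

namespace Summit.QuantumFields.BalabanUV.Beta.CapRows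

open Literature.MathematicalPhysics.QuantumFieldTheory.Balaban1983to89
open Literature.MathematicalPhysics.QuantumFieldTheory.Balaban1983to89.Beta
open FlowStep FlowStepRuns DagBinding
open Beta.RemainderChain (RemainderConst)
open Beta.RateCertificate (GeomRate)
open Beta.Certified (SmallKCert)
open Beta.AveragedAFCarrier (BetaAvgAFH)
open Beta.AveragedAFCarrierCertified (betaAvgAFH_of_certifiedConst_list)

/-! ## §1 The carrier -/

/-- **Certified rows up to `k₀`** for an abstract sequence `b : ℕ → ℝ`: DATA `k₀`, rational `lo`, and the COMPUTATIONAL LEAF `lo_le`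
(certified enclosures produced outside the kernel; a HYPOTHESIS of kind computational wherever consumed). -/
structure Rows (b : ℕ → ℝ) where
  /-- the last certified step: rows concern `k ≤ k₀`. -/
  k₀ : ℕ
  /-- certified rational lower bounds. -/
  lo : ℕ → ℚ
  /-- COMPUTATIONAL LEAF (hypothesis): `lo k ≤ b k` for `k ≤ k₀`. -/
  lo_le : ∀ k, k ≤ k₀ → ((lo k : ℚ) : ℝ) ≤ b k

namespace Rows

variable {b : ℕ → ℝ} (c : Rows b)

/-- the certified value at the last row, `m := lo k₀`. -/
def m : ℚ := c.lo c.k₀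

/-- the floor of the list, `m₀ := min_{k ≤ k₀} lo k`. -/
def m₀ : ℚ := (Finset.range (c.k₀ + 1)).inf' ⟨0, by simp⟩ c.lo

/-- `m₀ ≤ lo k` for every row. -/
theorem m₀_le (k : ℕ) (hk : k ≤ c.k₀) : c.m₀ ≤ c.lo k :=
  Finset.inf'_le _ (by simpa [Finset.mem_range, Nat.lt_succ_iff] using hk)

/-- `m₀ ≤ m`. -/
theorem m₀_le_m : c.m₀ ≤ c.m := c.m₀_le c.k₀ le_rfl

/-- THE LEAF `hcert : m ≤ b k₁` of the certified road, `k₁ := k₀`. -/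
theorem hcert : ((c.m : ℚ) : ℝ) ≤ b c.k₀ := c.lo_le c.k₀ le_rfl

/-- THE LEAF `hsmall : ∀ k < k₂, m₀ ≤ b k` of the certified road, `k₂ := k₀ + 1`. -/
theorem hsmall : ∀ k, k < c.k₀ + 1 → ((c.m₀ : ℚ) : ℝ) ≤ b k := fun k hk => by
  have hk' : k ≤ c.k₀ := Nat.lt_succ_iff.mp hk
  exact le_trans (by exact_mod_cast c.m₀_le k hk') (c.lo_le k hk')

/-- Restriction to fewer rows. -/
def restrict (k : ℕ) (hk : k ≤ c.k₀) : Rows b where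
  k₀ := k
  lo := c.lo
  lo_le j hj := c.lo_le j (hj.trans hk)

/-- **THE LEVEL-k DICTIONARY CONSTRUCTOR**: rows certified for a TYPED sequence `T` plus the identification `b k = T k` (`k ≤ k₀`) — a
HYPOTHESIS, (D1)-grade at each level — give rows for `b`. -/
def ofDict (T : ℕ → ℝ) (k₀ : ℕ) (lo : ℕ → ℚ) (hlo : ∀ k, k ≤ k₀ → ((lo k : ℚ) : ℝ) ≤ T k)
    (hdict : ∀ k, k ≤ k₀ → b k = T k) : Rows b where
  k₀ := k₀
  lo := lo
  lo_le k hk := by rw [hdict k hk]; exact hlo k hk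

/-- Back to cap3's limit-form carrier when a rational `bhi ≥ binf` with the thresholds `3·bhi/4 ≤ lo k` is supplied (length `k₀ + 1`). -/
def toSmallKCert {binf : ℝ} (bhi : ℚ) (hb : binf ≤ (bhi : ℝ)) (hthr : ∀ k, k ≤ c.k₀ → 3 * bhi / 4 ≤ c.lo k) :
    SmallKCert b binf where
  k₁ := c.k₀ + 1
  lo := c.lo
  lo_le k hk := c.lo_le k (Nat.lt_succ_iff.mp hk)
  bhi := bhi
  binf_le := hb
  thr_le k hk := hthr k (Nat.lt_succ_iff.mp hk)

/-- From cap3's carrier of positive length: its rows ARE certified rows (the thresholds are forgotten). -/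
def ofSmallKCert {binf : ℝ} (s : SmallKCert b binf) (hs : 0 < s.k₁) : Rows b where
  k₀ := s.k₁ - 1
  lo := s.lo
  lo_le k hk := s.lo_le k (by omega)

end Rows

/-! ## §2 Export into the certified road (binf-free) -/

variable {β : HBeta}

/-- **THE CERTIFIED ROAD ON THE ROWS**: rate + rows up to `k₀` + the rate-side comparison at `k₀ + 1` + constant remainder ⟹ the DEFECT-ZERO
averaged-AF carrier `BetaAvgAFH (min m₀ (3(m − c₀θ^{k₀})/4) − r) 0 γ₀ β` — literally `AveragedAFCarrierCertified.betaAvgAFH_of_certifiedConst_list`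
with `hcert := c.hcert`, `hsmall := c.hsmall`, `k₁ := k₀`, `k₂ := k₀ + 1`. [folklore] -/
theorem betaAvgAFH_of_capRows (S : B12Beta.OneLoopSplit β) (c : Rows S.β0) {γ₀ binf c₀ θ r : ℝ} (hθ0 : 0 ≤ θ) (hθ1 : θ ≤ 1)
    (hconv : GeomRate S.β0 binf c₀ θ) (hk₂ : c₀ * θ ^ (c.k₀ + 1) ≤ ((c.m : ℝ) - c₀ * θ ^ c.k₀) / 4) (hrem : RemainderConst S γ₀ r) :
    BetaAvgAFH (min (c.m₀ : ℝ) (3 * ((c.m : ℝ) - c₀ * θ ^ c.k₀) / 4) - r) 0 γ₀ β :=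
  betaAvgAFH_of_certifiedConst_list S hθ0 hθ1 hconv c.hcert hk₂ c.hsmall hrem

/-- **… THROUGH THE DICTIONARY**: rows certified for a typed sequence `T` + the identification `S.β0 k = T k` (`k ≤ k₀`, a BINDER) + the same
rate-side data ⟹ the same carrier. [folklore] -/
theorem betaAvgAFH_of_dict (S : B12Beta.OneLoopSplit β) (T : ℕ → ℝ) (k₀ : ℕ) (lo : ℕ → ℚ)
    (hlo : ∀ k, k ≤ k₀ → ((lo k : ℚ) : ℝ) ≤ T k) (hdict : ∀ k, k ≤ k₀ → S.β0 k = T k) {γ₀ binf c₀ θ r : ℝ} (hθ0 : 0 ≤ θ)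
    (hθ1 : θ ≤ 1) (hconv : GeomRate S.β0 binf c₀ θ) (hk₂ : c₀ * θ ^ (k₀ + 1) ≤ ((lo k₀ : ℝ) - c₀ * θ ^ k₀) / 4)
    (hrem : RemainderConst S γ₀ r) :
    BetaAvgAFH (min ((Rows.ofDict T k₀ lo hlo hdict).m₀ : ℝ) (3 * ((lo k₀ : ℝ) - c₀ * θ ^ k₀) / 4) - r) 0 γ₀ β :=
  betaAvgAFH_of_capRows S (Rows.ofDict T k₀ lo hlo hdict) hθ0 hθ1 hconv hk₂ hrem

/-! ## §3 Non-vacuity on asym2's witness `β⁰ ≡ 1` -/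

open Beta.Assembly.Witness (splitOne constOne)

/-- The one-row carrier on the witness split (`β⁰_{k+1} = 1` for all `k`): `k₀ = 0`, `lo 0 = 1`. -/
def capRowsOne : Rows splitOne.β0 where
  k₀ := 0
  lo := fun _ => 1
  lo_le k hk := by
    obtain rfl : k = 0 := Nat.le_zero.mp hk
    simp [Beta.Assembly.Witness.splitOne]

/-- its constants: `m = 1`, `m₀ = 1`. -/
theorem capRowsOne_consts : capRowsOne.m = 1 ∧ capRowsOne.m₀ = 1 := by
  refine ⟨rfl, ?_⟩
  simp [Rows.m₀, capRowsOne]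


/-! ## §4 Feasibility of the `k₀`-row anchor: what the RATE side must supply (gen 19)

Pure algebra over the binders of the two roads; nothing about Bałaban's coefficients is asserted.  On the certified road the
rate-side comparison `hk₂ : c₀θ^{k₀+1} ≤ (m − c₀θ^{k₀})/4` is `c₀θ^{k₀}(1 + 4θ) ≤ m`, and the rate hypothesis itself forces
`|b 0 − binf| ≤ c₀` (its `k = 0` instance); hence a cap of length `k₀ + 1` can serve the certified road ONLY IF
`θ^{k₀}(1 + 4θ)·|b 0 − binf| ≤ m ≤ b k₀`, and the margin road (`betaAvgAFH_of_marginConst`, constant `m − c₀θ^{k₁}(1+θ) − r`) ONLY IF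
`θ^{k₁}(1 + θ)·|b 0 − binf| ≤ m − r`.  For `k₀ = 0` this is a bound on `θ` by the two physical magnitudes `β⁰₁ = b 0` and `β∞ = binf`
alone: `θ ≤ binf/(4(b 0 − binf))` (certified road, `b 0 > binf`).  BINDER-OWNERS row CAP-k item (b): the `k = 0` anchor is worth
instantiating on the certified road only together with a rate whose constant `c₀` is within the factor `m/((1+4θ)|b 0 − binf|)` of tight. -/

section Feasibility

/-- `hk₂` rewritten: `c₀θ^{k₀+1} ≤ (m − c₀θ^{k₀})/4 ↔ c₀θ^{k₀}(1 + 4θ) ≤ m`. [folklore] -/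
theorem hk₂_iff {c₀ θ m : ℝ} {k₀ : ℕ} :
    c₀ * θ ^ (k₀ + 1) ≤ (m - c₀ * θ ^ k₀) / 4 ↔ c₀ * θ ^ k₀ * (1 + 4 * θ) ≤ m := by
  rw [pow_succ]
  constructor <;> intro h <;> nlinarith [h]

/-- The rate hypothesis at `k = 0` bounds its own constant from below: `|b 0 − binf| ≤ c₀`. [folklore] -/
theorem abs_sub_le_c₀_of_geomRate {b : ℕ → ℝ} {binf c₀ θ : ℝ} (h : GeomRate b binf c₀ θ) : |b 0 - binf| ≤ c₀ := by
  simpa using h 0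

/-- hence `0 ≤ c₀` under the rate hypothesis. [folklore] -/
theorem c₀_nonneg_of_geomRate {b : ℕ → ℝ} {binf c₀ θ : ℝ} (h : GeomRate b binf c₀ θ) : 0 ≤ c₀ :=
  (abs_nonneg _).trans (abs_sub_le_c₀_of_geomRate h)

/-- **NECESSARY CONDITION, CERTIFIED ROAD.**  Rate + `0 ≤ θ` + the comparison `hk₂` at the rows' `k₀` (with `m := lo k₀`) force
`θ^{k₀}(1 + 4θ)·|b 0 − binf| ≤ m`. [folklore] -/
theorem Rows.anchor_necessary {b : ℕ → ℝ} (c : Rows b) {binf c₀ θ : ℝ} (hconv : GeomRate b binf c₀ θ) (hθ0 : 0 ≤ θ)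
    (hk₂ : c₀ * θ ^ (c.k₀ + 1) ≤ ((c.m : ℝ) - c₀ * θ ^ c.k₀) / 4) :
    θ ^ c.k₀ * (1 + 4 * θ) * |b 0 - binf| ≤ (c.m : ℝ) := by
  have h1 : c₀ * θ ^ c.k₀ * (1 + 4 * θ) ≤ (c.m : ℝ) := hk₂_iff.mp hk₂
  have h2 : |b 0 - binf| ≤ c₀ := abs_sub_le_c₀_of_geomRate hconv
  have h3 : 0 ≤ θ ^ c.k₀ * (1 + 4 * θ) := by positivity
  calc θ ^ c.k₀ * (1 + 4 * θ) * |b 0 - binf| ≤ θ ^ c.k₀ * (1 + 4 * θ) * c₀ :=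
        mul_le_mul_of_nonneg_left h2 h3
    _ = c₀ * θ ^ c.k₀ * (1 + 4 * θ) := by ring
    _ ≤ (c.m : ℝ) := h1

/-- … and since `m ≤ b k₀` (`hcert`): `θ^{k₀}(1 + 4θ)·|b 0 − binf| ≤ b k₀`. [folklore] -/
theorem Rows.anchor_necessary' {b : ℕ → ℝ} (c : Rows b) {binf c₀ θ : ℝ} (hconv : GeomRate b binf c₀ θ) (hθ0 : 0 ≤ θ)
    (hk₂ : c₀ * θ ^ (c.k₀ + 1) ≤ ((c.m : ℝ) - c₀ * θ ^ c.k₀) / 4) :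
    θ ^ c.k₀ * (1 + 4 * θ) * |b 0 - binf| ≤ b c.k₀ :=
  (c.anchor_necessary hconv hθ0 hk₂).trans c.hcert

/-- **NECESSARY CONDITION, MARGIN ROAD.**  Rate + `0 ≤ θ` + a non-negative carrier constant `0 ≤ m − c₀θ^{k₁}(1 + θ) − r` of
`betaAvgAFH_of_marginConst` force `θ^{k₁}(1 + θ)·|b 0 − binf| ≤ m − r`. [folklore] -/
theorem margin_necessary {b : ℕ → ℝ} {binf c₀ θ m r : ℝ} {k₁ : ℕ} (hconv : GeomRate b binf c₀ θ) (hθ0 : 0 ≤ θ)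
    (hpos : 0 ≤ m - c₀ * θ ^ k₁ * (1 + θ) - r) : θ ^ k₁ * (1 + θ) * |b 0 - binf| ≤ m - r := by
  have h2 : |b 0 - binf| ≤ c₀ := abs_sub_le_c₀_of_geomRate hconv
  have h3 : 0 ≤ θ ^ k₁ * (1 + θ) := by positivity
  calc θ ^ k₁ * (1 + θ) * |b 0 - binf| ≤ θ ^ k₁ * (1 + θ) * c₀ := mul_le_mul_of_nonneg_left h2 h3
    _ = c₀ * θ ^ k₁ * (1 + θ) := by ring
    _ ≤ m - r := by linarith

/-- **THE `k₀ = 0` ANCHOR, SOLVED FOR `θ`** (certified road, `b 0 > binf`): `(1 + 4θ)(b 0 − binf) ≤ b 0` gives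
`θ ≤ binf / (4 (b 0 − binf))`. [folklore] -/
theorem theta_le_of_anchor_zero {b0 binf θ : ℝ} (hlt : binf < b0) (h : (1 + 4 * θ) * (b0 - binf) ≤ b0) :
    θ ≤ binf / (4 * (b0 - binf)) := by
  rw [le_div_iff₀ (by linarith)]
  nlinarith

/-- The `k₀ = 0` instance of `anchor_necessary'` in the solved form: a one-row cap (`k₀ = 0`) on the certified road with
`b 0 > binf` needs `θ ≤ binf / (4 (b 0 − binf))`. [folklore] -/
theorem Rows.theta_le_of_anchor_zero {b : ℕ → ℝ} (c : Rows b) (hk : c.k₀ = 0) {binf c₀ θ : ℝ}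
    (hconv : GeomRate b binf c₀ θ) (hθ0 : 0 ≤ θ) (hlt : binf < b 0)
    (hk₂ : c₀ * θ ^ (c.k₀ + 1) ≤ ((c.m : ℝ) - c₀ * θ ^ c.k₀) / 4) : θ ≤ binf / (4 * (b 0 - binf)) := by
  have h := c.anchor_necessary' hconv hθ0 hk₂
  rw [hk, pow_zero, one_mul] at h
  rw [abs_of_pos (sub_pos.mpr hlt)] at h
  exact CapRows.theta_le_of_anchor_zero hlt h

/-- WORKED SIZE under EXPLICIT NUMERICAL HYPOTHESES (binders — evidence-grade magnitudes, NOT certified and NOT asserted here: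
`binf ≤ 0.40815` is `Certified.stepBal_two_three_le`'s value IF `β∞ = stepBal 2 3`; `0.6612 ≤ b 0` is the single-engine grid trend
`T^mid_8 … T^mid_12 ≈ 0.66126` of BETA/CERT.md v2.4 IF the level-0 dictionary holds): then a `k₀ = 0` cap on the certified road needs
`θ ≤ 0.4033`, i.e. a rate constant `c₀ ∈ [b 0 − binf, b 0/(1 + 4θ)]` — at `θ = 1/3` a window of width < 12 %. [folklore] -/
theorem theta_le_worked {b0 binf θ : ℝ} (hbinf : binf ≤ 0.40815) (hb0 : 0.6612 ≤ b0) (hθ0 : 0 ≤ θ)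
    (h : (1 + 4 * θ) * (b0 - binf) ≤ b0) : θ ≤ 0.4033 := by
  nlinarith

end Feasibility

/-! ## §5 The `k₀ = 0` anchor from cap3's aliasing leaves, binf-FREE (gen 19; BINDER-OWNERS row CAP-k item (b), the shell)

`Certified.SmallKCert.oneOfAliasing` builds cap3's LIMIT-currency carrier (it wants `bhi ≥ binf` and the threshold `3·bhi/4 ≤ lo`).  The
certified ∕ margin roads are binf-free, so the anchor they consume is just ONE ROW: the level-0 dictionary (N) `b 0 = Re (latticeKernel G 0)`
(a BINDER — (D1)-grade at level 0), strip regularity (Z) of the typed one-loop integrand `G`, an engine enclosure (T) of its torus grid mean at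
period `N` (two engines), a majorant (A) of the aliasing tail and ONE rational comparison give `Rows b` with `k₀ = 0`, `lo 0 = lo`.  Two rates:
cap3's sup-norm rate (`Certified.lo_le_of_aliasing`, tail `M·aliasConst κ N d`) and the sharper `ℓ¹` rate (`AliasingTailL1.lo_le_of_aliasing_l1`,
tail `M·aliasConstL1 κ N d`, strip regularity in the `StripRegularC` form).  Nothing is instantiated: no `G`, no `N`, no number. -/

section Anchor

open Beta.AliasingTail (aliasConst)
open Beta.AliasingTailL1 (StripRegularC aliasConstL1 lo_le_of_aliasing_l1)
open Beta.Certified (lo_le_of_aliasing)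

variable {d : ℕ} {b : ℕ → ℝ}

/-- **THE ANCHOR ROW (sup-norm rate).**  (N) + (Z) + (T) + (A) + `lo ≤ t − r − A` ⟹ `Rows b` with `k₀ = 0`. [folklore] -/
def Rows.ofAliasing {G : (Fin (d + 1) → ℂ) → ℂ} {κ M : ℝ} (hb : b 0 = (B4ContourShift.latticeKernel G 0).re)
    (h : B4ContourShift.StripRegular G κ M) (hκ : 0 < κ) {N : ℕ} (hN : 1 ≤ N) {t r : ℝ}
    (hT : ‖B4TorusKernel.torusKernel (B4TorusKernel.descendC G h hκ.le) N 0 - t‖ ≤ r)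
    {A : ℝ} (hA : M * aliasConst κ N d ≤ A) (lo : ℚ) (hlo : ((lo : ℚ) : ℝ) ≤ t - r - A) : Rows b where
  k₀ := 0
  lo := fun _ => lo
  lo_le k hk := by
    obtain rfl : k = 0 := Nat.le_zero.mp hk
    rw [hb]
    exact lo_le_of_aliasing h hκ hN hT hA hlo

/-- its constants: `k₀ = 0`, `m = m₀ = lo`. [folklore] -/
theorem Rows.ofAliasing_consts {G : (Fin (d + 1) → ℂ) → ℂ} {κ M : ℝ} (hb : b 0 = (B4ContourShift.latticeKernel G 0).re)
    (h : B4ContourShift.StripRegular G κ M) (hκ : 0 < κ) {N : ℕ} (hN : 1 ≤ N) {t r : ℝ}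
    (hT : ‖B4TorusKernel.torusKernel (B4TorusKernel.descendC G h hκ.le) N 0 - t‖ ≤ r)
    {A : ℝ} (hA : M * aliasConst κ N d ≤ A) (lo : ℚ) (hlo : ((lo : ℚ) : ℝ) ≤ t - r - A) :
    (Rows.ofAliasing hb h hκ hN hT hA lo hlo).k₀ = 0 ∧ (Rows.ofAliasing hb h hκ hN hT hA lo hlo).m = lo ∧
      (Rows.ofAliasing hb h hκ hN hT hA lo hlo).m₀ = lo := by
  refine ⟨rfl, rfl, ?_⟩
  simp [Rows.m₀, Rows.ofAliasing]

/-- **THE ANCHOR ROW (`ℓ¹` rate).**  The same with `StripRegularC` and the tail `M·aliasConstL1 κ N d`. [folklore] -/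
def Rows.ofAliasingL1 {G : (Fin (d + 1) → ℂ) → ℂ} {κ M : ℝ} (hb : b 0 = (B4ContourShift.latticeKernel G 0).re)
    (h : StripRegularC G κ M) (hκ : 0 < κ) {N : ℕ} (hN : 1 ≤ N) {t r : ℝ}
    (hT : ‖B4TorusKernel.torusKernel (B4TorusKernel.descendC G (h.toStripRegular hκ.le) hκ.le) N 0 - t‖ ≤ r)
    {A : ℝ} (hA : M * aliasConstL1 κ N d ≤ A) (lo : ℚ) (hlo : ((lo : ℚ) : ℝ) ≤ t - r - A) : Rows b where
  k₀ := 0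
  lo := fun _ => lo
  lo_le k hk := by
    obtain rfl : k = 0 := Nat.le_zero.mp hk
    rw [hb]
    exact lo_le_of_aliasing_l1 h hκ hN hT hA hlo

/-- **THE CERTIFIED ROAD FROM THE ANCHOR** (`ℓ¹` rate): anchor row + rate + the comparison `c₀θ ≤ (lo − c₀)/4` + constant remainder ⟹
`BetaAvgAFH (min lo (3(lo − c₀)/4) − r′) 0 γ₀ β`; by §4 this is only ever inhabited when `(1 + 4θ)|β⁰₁ − β∞| ≤ lo`. [folklore] -/
theorem betaAvgAFH_of_anchorL1 (S : B12Beta.OneLoopSplit β) {G : (Fin (d + 1) → ℂ) → ℂ} {κ M : ℝ}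
    (hb : S.β0 0 = (B4ContourShift.latticeKernel G 0).re) (h : StripRegularC G κ M) (hκ : 0 < κ) {N : ℕ} (hN : 1 ≤ N)
    {t rT : ℝ} (hT : ‖B4TorusKernel.torusKernel (B4TorusKernel.descendC G (h.toStripRegular hκ.le) hκ.le) N 0 - t‖ ≤ rT)
    {A : ℝ} (hA : M * aliasConstL1 κ N d ≤ A) (lo : ℚ) (hlo : ((lo : ℚ) : ℝ) ≤ t - rT - A)
    {γ₀ binf c₀ θ r : ℝ} (hθ0 : 0 ≤ θ) (hθ1 : θ ≤ 1) (hconv : GeomRate S.β0 binf c₀ θ)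
    (hk₂ : c₀ * θ ^ (0 + 1) ≤ ((lo : ℝ) - c₀ * θ ^ 0) / 4) (hrem : RemainderConst S γ₀ r) :
    BetaAvgAFH (min ((Rows.ofAliasingL1 hb h hκ hN hT hA lo hlo).m₀ : ℝ) (3 * ((lo : ℝ) - c₀ * θ ^ 0) / 4) - r) 0 γ₀ β :=
  betaAvgAFH_of_capRows S (Rows.ofAliasingL1 hb h hκ hN hT hA lo hlo) hθ0 hθ1 hconv hk₂ hrem

end Anchor

/-! ## §6 (v1.1, APPEND-ONLY) The `k₀ = 0` anchor from cap3's TWO-STRATA leaf (the one-coordinate lever; CAP-KERNEL v0.5.8 §4.12)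

cap3-g6's `AliasingTailStrata` (p198472) splits the aliasing tail into the AXIAL stratum, fed by ONE-COORDINATE data at a large half-width `κ`
(`∀ i, SliceRegular G i κ M₁`, or boundary data `∀ i, BoundarySliceRegular G i κ M₁` on the `2(d+1)` shifted real tori `Im q_i = ±κ`), with constant
`axialConst κ N d = 2(d+1)ρ/(1−ρ)` (`ρ = e^{−κN}`; ten times below `aliasConst`), and the BULK stratum, fed by the polystrip data `StripRegularC G κ′ M′`
at a small `κ′`, with constant `bulkConst κ′ N d ≈ 24ρ′²`.  The anchor row in that currency (cap3's invitation, journal 2026-08-19T22:55:10Z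
«a third row shape `Rows.ofAliasingStrata` is now possible»); the one extra import is `AliasingTailStrata`.  Nothing instantiated. -/

section AnchorStrata

open Beta.AliasingTailL1 (StripRegularC)
open Beta.AliasingTailSlice (BoundarySliceRegular)
open Beta.AliasingTailStrata (axialConst bulkConst lo_le_of_aliasing_strata lo_le_of_aliasing_strata_boundary)

variable {d : ℕ} {b : ℕ → ℝ}

/-- **THE ANCHOR ROW, TWO STRATA (slice data).**  (N) + bulk (Z′) `StripRegularC G κ′ M′` + axial (Z¹) `∀ i, SliceRegular G i κ M₁` + (T) +
(A) `M₁·axialConst κ N d + M′·bulkConst κ′ N d ≤ A` + `lo ≤ t − r − A` ⟹ `Rows b` with `k₀ = 0`. [folklore] -/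
def Rows.ofAliasingStrata {G : (Fin (d + 1) → ℂ) → ℂ} {κ' M' κ M₁ : ℝ} (hb : b 0 = (B4ContourShift.latticeKernel G 0).re)
    (h' : StripRegularC G κ' M') (hκ' : 0 < κ') (hκ : 0 < κ) (hreg : ∀ i, B4ContourShift.SliceRegular G i κ M₁) {N : ℕ} (hN : 1 ≤ N)
    {t r : ℝ} (hT : ‖B4TorusKernel.torusKernel (B4TorusKernel.descendC G (h'.toStripRegular hκ'.le) hκ'.le) N 0 - t‖ ≤ r)
    {A : ℝ} (hA : M₁ * axialConst κ N d + M' * bulkConst κ' N d ≤ A) (lo : ℚ) (hlo : ((lo : ℚ) : ℝ) ≤ t - r - A) : Rows b where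
  k₀ := 0
  lo := fun _ => lo
  lo_le k hk := by
    obtain rfl : k = 0 := Nat.le_zero.mp hk
    rw [hb]
    exact lo_le_of_aliasing_strata h' hκ' hκ hreg hN hT hA hlo

/-- **THE ANCHOR ROW, TWO STRATA (boundary data)** — the cheap-lane currency: `M₁` bounds `|G|` only on the `2(d+1)` one-coordinate shifted
real tori `Im q_i = ±κ` (`∀ i, BoundarySliceRegular G i κ M₁`, maximum modulus inside). [folklore] -/
def Rows.ofAliasingStrataBoundary {G : (Fin (d + 1) → ℂ) → ℂ} {κ' M' κ M₁ : ℝ} (hb : b 0 = (B4ContourShift.latticeKernel G 0).re)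
    (h' : StripRegularC G κ' M') (hκ' : 0 < κ') (hκ : 0 < κ) (hreg : ∀ i, BoundarySliceRegular G i κ M₁) {N : ℕ} (hN : 1 ≤ N)
    {t r : ℝ} (hT : ‖B4TorusKernel.torusKernel (B4TorusKernel.descendC G (h'.toStripRegular hκ'.le) hκ'.le) N 0 - t‖ ≤ r)
    {A : ℝ} (hA : M₁ * axialConst κ N d + M' * bulkConst κ' N d ≤ A) (lo : ℚ) (hlo : ((lo : ℚ) : ℝ) ≤ t - r - A) : Rows b where
  k₀ := 0
  lo := fun _ => lo
  lo_le k hk := by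
    obtain rfl : k = 0 := Nat.le_zero.mp hk
    rw [hb]
    exact lo_le_of_aliasing_strata_boundary h' hκ' hκ hreg hN hT hA hlo

/-- its constants: `k₀ = 0`, `m = m₀ = lo`. [folklore] -/
theorem Rows.ofAliasingStrataBoundary_consts {G : (Fin (d + 1) → ℂ) → ℂ} {κ' M' κ M₁ : ℝ}
    (hb : b 0 = (B4ContourShift.latticeKernel G 0).re) (h' : StripRegularC G κ' M') (hκ' : 0 < κ') (hκ : 0 < κ)
    (hreg : ∀ i, BoundarySliceRegular G i κ M₁) {N : ℕ} (hN : 1 ≤ N) {t r : ℝ}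
    (hT : ‖B4TorusKernel.torusKernel (B4TorusKernel.descendC G (h'.toStripRegular hκ'.le) hκ'.le) N 0 - t‖ ≤ r)
    {A : ℝ} (hA : M₁ * axialConst κ N d + M' * bulkConst κ' N d ≤ A) (lo : ℚ) (hlo : ((lo : ℚ) : ℝ) ≤ t - r - A) :
    (Rows.ofAliasingStrataBoundary hb h' hκ' hκ hreg hN hT hA lo hlo).k₀ = 0 ∧
      (Rows.ofAliasingStrataBoundary hb h' hκ' hκ hreg hN hT hA lo hlo).m = lo ∧
      (Rows.ofAliasingStrataBoundary hb h' hκ' hκ hreg hN hT hA lo hlo).m₀ = lo := by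
  refine ⟨rfl, rfl, ?_⟩
  simp [Rows.m₀, Rows.ofAliasingStrataBoundary]

variable {β : HBeta}

/-- **THE CERTIFIED ROAD FROM THE TWO-STRATA ANCHOR (boundary data)**: anchor row + rate + `hk₂` at `k₀ = 0` + constant remainder ⟹
`BetaAvgAFH (min lo (3(lo − c₀)/4) − r″) 0 γ₀ β` (`betaAvgAFH_of_capRows` on the row; §4's feasibility conditions apply verbatim). [folklore] -/
theorem betaAvgAFH_of_anchorStrataBoundary (S : B12Beta.OneLoopSplit β) {G : (Fin (d + 1) → ℂ) → ℂ} {κ' M' κ M₁ : ℝ}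
    (hb : S.β0 0 = (B4ContourShift.latticeKernel G 0).re) (h' : StripRegularC G κ' M') (hκ' : 0 < κ') (hκ : 0 < κ)
    (hreg : ∀ i, BoundarySliceRegular G i κ M₁) {N : ℕ} (hN : 1 ≤ N) {t rT : ℝ}
    (hT : ‖B4TorusKernel.torusKernel (B4TorusKernel.descendC G (h'.toStripRegular hκ'.le) hκ'.le) N 0 - t‖ ≤ rT)
    {A : ℝ} (hA : M₁ * axialConst κ N d + M' * bulkConst κ' N d ≤ A) (lo : ℚ) (hlo : ((lo : ℚ) : ℝ) ≤ t - rT - A)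
    {γ₀ binf c₀ θ r : ℝ} (hθ0 : 0 ≤ θ) (hθ1 : θ ≤ 1) (hconv : GeomRate S.β0 binf c₀ θ)
    (hk₂ : c₀ * θ ^ (0 + 1) ≤ ((lo : ℝ) - c₀ * θ ^ 0) / 4) (hrem : RemainderConst S γ₀ r) :
    BetaAvgAFH (min ((lo : ℚ) : ℝ) (3 * ((lo : ℝ) - c₀ * θ ^ 0) / 4) - r) 0 γ₀ β := by
  have key := betaAvgAFH_of_capRows S (Rows.ofAliasingStrataBoundary hb h' hκ' hκ hreg hN hT hA lo hlo) hθ0 hθ1 hconv hk₂ hrem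
  rwa [(Rows.ofAliasingStrataBoundary_consts hb h' hκ' hκ hreg hN hT hA lo hlo).2.2] at key

end AnchorStrata

end Summit.QuantumFields.BalabanUV.Beta.CapRows
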